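import Mathlib
import HarnessLib
import Literature.Analysis.Matrix.GrothendieckInequality
import Summits.QuantumAdvantage.QuantumAdvantage.Theorems.SoloInformedGrothendieckFrobenius

/-!
# LEMMA M: the coordinate Lipschitz constants of a bounded quadratic are `ℓ₂`-small
# (row `ℓ₁`-norms of a cube-bounded matrix lie in `ℓ₂`, conditional only on `GrothendieckFactorization`)

Solo seat `solo-QuantumAdvantage-informed`, session 14, file 32 (§4.28 (3) of the seat's paper).

For a real symmetric matrix `A` with `|sᵀAt| ≤ M` on sign vectors (`‖A‖_{∞→1} ≤ M`) the symmetric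
Grothendieck factorization `|xᵀAy| ≤ K·M·‖x‖_{L₂(w)}‖y‖_{L₂(w)}` (`Σ w ≤ 1`, `K = krivineBound`;
`Literature.Analysis.Matrix.grothendieckFactorization_symm`, proved from the named fact
`GrothendieckFactorization`) tested on `(eᵢ, sgn rowᵢ A)` gives `Σ_j |A_{ij}| ≤ K·M·√wᵢ`, hence

* `row_l1_le_of_factorization`, `row_l1_sq_sum_of_factorization` — from ANY factorization:
  `Σ_j |A_{ij}| ≤ K√wᵢ` and `Σ_i (Σ_j |A_{ij}|)² ≤ K²`; `heavy_rows_card_le` — at most `K²/t²` rows have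
  `ℓ₁`-norm `≥ t` (Markov);
* `row_l1_sq_sum_le` — with Grothendieck's inequality: `Σ_i (Σ_j |A_{ij}|)² ≤ (K·M)²`;
* `coord_derivative`, `lineCoeff_abs_le`, `coord_lipschitz` — for `q = c + ⟨b,x⟩ + xᵀAx` (`A` symmetric,
  zero diagonal) the `i`-th discrete derivative at a vertex is `bᵢ + lineCoeff A x i` and is bounded by
  `Lipᵢ := |bᵢ| + 2Σ_j|A_{ij}|`;
* `lipschitz_sq_sum_le` — LEMMA M: if `q ∈ [0,1]` on `{−1,1}ⁿ` then `Σᵢ Lipᵢ² ≤ 1/2 + 8K²`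
  (`2‖b‖₂² ≤ 2‖b‖₁² ≤ 1/2` by F1 `linear_part_l1_le`, and the row bound with `M = 1` by F4
  `sign_bilinear_abs_le_one`); `lipschitz_sq_sum_lt` — numerically `< 65/2` (`krivineBound < 2`).

So a bounded quadratic — the acceptance probability of a one-query quantum algorithm as a function of
the input string — has total squared coordinate-Lipschitz mass `O(1)` DIMENSION-FREE, although each
single `Lipᵢ` can be `≍ 1` and `Σᵢ Lipᵢ` can be `≍ √n`. Trust base: Mathlib + the named fact
`GrothendieckFactorization` (only for the last three statements; the factorization lemmas are
unconditional).
-/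

namespace Summit.QuantumAdvantage.QuantumAdvantage.Theorems

namespace BoundedQuadratic

open Finset Literature.Analysis.Matrix

variable {n : ℕ}

/-! ## Row `ℓ₁`-norms from a factorization -/

/-- From a factorization `|xᵀAy| ≤ K‖x‖_{L₂(w)}‖y‖_{L₂(w)}` with `Σ w ≤ 1`: every row has
`Σ_j |A i j| ≤ K √(w i)` (test on `x = eᵢ`, `y = sgn(row i)`). -/
theorem row_l1_le_of_factorization (A : Matrix (Fin n) (Fin n) ℝ) {K : ℝ} (hK : 0 ≤ K)
    (w : Fin n → ℝ) (hw1 : ∑ i, w i ≤ 1)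
    (hfac : ∀ x y : Fin n → ℝ, |∑ i, ∑ j, A i j * x i * y j| ≤
      K * Real.sqrt (∑ i, w i * x i ^ 2) * Real.sqrt (∑ i, w i * y i ^ 2))
    (i : Fin n) :
    ∑ j, |A i j| ≤ K * Real.sqrt (w i) := by
  classical
  set x : Fin n → ℝ := fun a => if a = i then 1 else 0 with hx
  set y : Fin n → ℝ := fun b => if 0 ≤ A i b then 1 else -1 with hy
  have hbil : ∑ a, ∑ b, A a b * x a * y b = ∑ j, |A i j| := by
    rw [Finset.sum_eq_single i (fun a _ ha => by simp [hx, ha]) (fun h => absurd (mem_univ i) h)]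
    refine sum_congr rfl fun b _ => ?_
    have hxi : x i = 1 := by simp [hx]
    rw [hxi]
    by_cases h : 0 ≤ A i b
    · simp [hy, h, abs_of_nonneg h]
    · simp [hy, h, abs_of_neg (lt_of_not_ge h)]
  have hxw : ∑ a, w a * x a ^ 2 = w i := by
    rw [Finset.sum_eq_single i (fun a _ ha => by simp [hx, ha]) (fun h => absurd (mem_univ i) h)]
    simp [hx]
  have hyw : ∑ b, w b * y b ^ 2 = ∑ b, w b := by
    refine sum_congr rfl fun b _ => ?_
    by_cases h : 0 ≤ A i b <;> simp [hy, h]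
  have h := hfac x y
  rw [hbil, hxw, hyw] at h
  have h1 : Real.sqrt (∑ b, w b) ≤ 1 := by
    rw [show (1:ℝ) = Real.sqrt 1 from Real.sqrt_one.symm]
    exact Real.sqrt_le_sqrt hw1
  calc ∑ j, |A i j| ≤ abs (∑ j, |A i j|) := le_abs_self _
    _ ≤ K * Real.sqrt (w i) * Real.sqrt (∑ b, w b) := h
    _ ≤ K * Real.sqrt (w i) * 1 :=
        mul_le_mul_of_nonneg_left h1 (mul_nonneg hK (Real.sqrt_nonneg _))
    _ = K * Real.sqrt (w i) := by ring

/-- Row `ℓ₁`-norms are square-summable: `Σ_i (Σ_j |A i j|)² ≤ K² Σ w ≤ K²`. -/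
theorem row_l1_sq_sum_of_factorization (A : Matrix (Fin n) (Fin n) ℝ) {K : ℝ} (hK : 0 ≤ K)
    (w : Fin n → ℝ) (hw : ∀ i, 0 ≤ w i) (hw1 : ∑ i, w i ≤ 1)
    (hfac : ∀ x y : Fin n → ℝ, |∑ i, ∑ j, A i j * x i * y j| ≤
      K * Real.sqrt (∑ i, w i * x i ^ 2) * Real.sqrt (∑ i, w i * y i ^ 2)) :
    ∑ i, (∑ j, |A i j|) ^ 2 ≤ K ^ 2 := by
  have hrow := row_l1_le_of_factorization A hK w hw1 hfac
  calc ∑ i, (∑ j, |A i j|) ^ 2 ≤ ∑ i, (K * Real.sqrt (w i)) ^ 2 := by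
        refine sum_le_sum fun i _ => ?_
        have h0 : 0 ≤ ∑ j, |A i j| := sum_nonneg fun j _ => abs_nonneg _
        exact pow_le_pow_left₀ h0 (hrow i) 2
    _ = K ^ 2 * ∑ i, w i := by
        rw [mul_sum]
        refine sum_congr rfl fun i _ => ?_
        rw [mul_pow, Real.sq_sqrt (hw i)]
    _ ≤ K ^ 2 * 1 := mul_le_mul_of_nonneg_left hw1 (sq_nonneg K)
    _ = K ^ 2 := by ring

/-- **Heavy rows are few.** From a factorization, at most `K²/t²` rows have `ℓ₁`-norm `≥ t`. -/
theorem heavy_rows_card_le (A : Matrix (Fin n) (Fin n) ℝ) {K : ℝ} (hK : 0 ≤ K)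
    (w : Fin n → ℝ) (hw : ∀ i, 0 ≤ w i) (hw1 : ∑ i, w i ≤ 1)
    (hfac : ∀ x y : Fin n → ℝ, |∑ i, ∑ j, A i j * x i * y j| ≤
      K * Real.sqrt (∑ i, w i * x i ^ 2) * Real.sqrt (∑ i, w i * y i ^ 2))
    {t : ℝ} (ht : 0 < t) :
    ((univ.filter fun i => t ≤ ∑ j, |A i j|).card : ℝ) ≤ K ^ 2 / t ^ 2 := by
  have hS := row_l1_sq_sum_of_factorization A hK w hw hw1 hfac
  rw [le_div_iff₀ (by positivity)]
  calc ((univ.filter fun i => t ≤ ∑ j, |A i j|).card : ℝ) * t ^ 2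
        = ∑ i ∈ univ.filter (fun i => t ≤ ∑ j, |A i j|), t ^ 2 := by
          rw [sum_const, nsmul_eq_mul]
    _ ≤ ∑ i ∈ univ.filter (fun i => t ≤ ∑ j, |A i j|), (∑ j, |A i j|) ^ 2 :=
          sum_le_sum fun i hi => pow_le_pow_left₀ ht.le (mem_filter.mp hi).2 2
    _ ≤ ∑ i, (∑ j, |A i j|) ^ 2 :=
          sum_le_sum_of_subset_of_nonneg (filter_subset _ _) fun i _ _ => sq_nonneg _
    _ ≤ K ^ 2 := hS

/-- **Row `ℓ₁`-norms of a cube-bounded symmetric matrix are in `ℓ₂`, conditional on Grothendieck's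
inequality:** `‖A‖_{∞→1} ≤ M` (on sign vectors) implies `Σ_i (Σ_j |A i j|)² ≤ (K·M)²`,
`K = krivineBound < 2`. (Sharp up to the constant: `A = ` a perfect matching scaled by `M/n`… has
equality pattern; a single heavy row `A_{1j} = M/(2n)` shows one row can carry `ℓ₁`-mass `≍ M`.) -/
theorem row_l1_sq_sum_le (hGT : GrothendieckFactorization) (A : Matrix (Fin n) (Fin n) ℝ)
    (hA : ∀ i j, A i j = A j i) {M : ℝ} (hM0 : 0 ≤ M)
    (hM : ∀ s t : Fin n → ℝ, (∀ i, s i = 1 ∨ s i = -1) → (∀ j, t j = 1 ∨ t j = -1) →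
      |∑ i, ∑ j, A i j * s i * t j| ≤ M) :
    ∑ i, (∑ j, |A i j|) ^ 2 ≤ (krivineBound * M) ^ 2 := by
  obtain ⟨w, hw, hw1, hfac⟩ := grothendieckFactorization_symm hGT A hA hM
  exact row_l1_sq_sum_of_factorization A (mul_nonneg krivineBound_pos.le hM0) w hw hw1 hfac

/-! ## Coordinate derivatives of a quadratic at the vertices -/

/-- Splitting a linear form at an updated coordinate: `Σ_k b_k (x^{i→t})_k = bᵢ t + Σ_{k≠i} b_k x_k`. -/
lemma linear_update (b x : Fin n → ℝ) (i : Fin n) (t : ℝ) :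
    ∑ k, b k * Function.update x i t k = b i * t + ∑ k ∈ univ.erase i, b k * x k := by
  classical
  rw [← Finset.add_sum_erase _ _ (mem_univ i), Function.update_self]
  congr 1
  exact sum_congr rfl fun k hk => by rw [Function.update_of_ne (mem_erase.mp hk).1]

/-- The `i`-th discrete derivative of `q = c + ⟨b,x⟩ + xᵀAx` (with `A i i = 0`):
`q(x^{i→1}) − q(x^{i→−1}) = 2 bᵢ + 2·lineCoeff A x i`. -/
theorem coord_derivative (c : ℝ) (b : Fin n → ℝ) (A : Matrix (Fin n) (Fin n) ℝ) {i : Fin n}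
    (hAii : A i i = 0) (x : Fin n → ℝ) :
    (c + ∑ k, b k * Function.update x i 1 k + quadForm A (Function.update x i 1)) -
      (c + ∑ k, b k * Function.update x i (-1) k + quadForm A (Function.update x i (-1)))
      = 2 * b i + 2 * lineCoeff A x i := by
  classical
  rw [linear_update, linear_update,
    quadForm_eq_of_agree_off A hAii (fun j hj => Function.update_of_ne hj (1:ℝ) x),
    quadForm_eq_of_agree_off A hAii (fun j hj => Function.update_of_ne hj (-1:ℝ) x),
    Function.update_self, Function.update_self]
  ring

/-- At a vertex, `|lineCoeff A x i| ≤ 2 Σ_j |A i j|` for symmetric `A`. -/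
theorem lineCoeff_abs_le (A : Matrix (Fin n) (Fin n) ℝ) (hA : ∀ i j, A i j = A j i)
    {x : Fin n → ℝ} (hx : IsSignVec x) (i : Fin n) :
    |lineCoeff A x i| ≤ 2 * ∑ j, |A i j| := by
  classical
  unfold lineCoeff
  have habs1 : ∀ k, |x k| = 1 := fun k => by rcases hx k with h | h <;> simp [h]
  have h1 : |∑ k ∈ univ.erase i, A i k * x k| ≤ ∑ j, |A i j| := by
    calc |∑ k ∈ univ.erase i, A i k * x k| ≤ ∑ k ∈ univ.erase i, |A i k * x k| :=
          abs_sum_le_sum_abs _ _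
      _ = ∑ k ∈ univ.erase i, |A i k| := sum_congr rfl fun k _ => by
            rw [abs_mul, habs1 k, mul_one]
      _ ≤ ∑ j, |A i j| :=
          sum_le_sum_of_subset_of_nonneg (erase_subset _ _) fun j _ _ => abs_nonneg _
  have h2 : |∑ j ∈ univ.erase i, A j i * x j| ≤ ∑ j, |A i j| := by
    calc |∑ j ∈ univ.erase i, A j i * x j| ≤ ∑ j ∈ univ.erase i, |A j i * x j| :=
          abs_sum_le_sum_abs _ _
      _ = ∑ j ∈ univ.erase i, |A i j| := sum_congr rfl fun j _ => by
            rw [abs_mul, habs1 j, mul_one, hA j i]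
      _ ≤ ∑ j, |A i j| :=
          sum_le_sum_of_subset_of_nonneg (erase_subset _ _) fun j _ _ => abs_nonneg _
  calc |∑ k ∈ univ.erase i, A i k * x k + ∑ j ∈ univ.erase i, A j i * x j|
        ≤ |∑ k ∈ univ.erase i, A i k * x k| + |∑ j ∈ univ.erase i, A j i * x j| := abs_add_le _ _
    _ ≤ 2 * ∑ j, |A i j| := by linarith

/-- **Coordinate Lipschitz constants.** For `q = c + ⟨b,x⟩ + xᵀAx` (`A` symmetric, zero diagonal) and
every vertex `x`: `|q(x^{i→1}) − q(x^{i→−1})|/2 ≤ Lipᵢ := |bᵢ| + 2 Σ_j |A i j|`. -/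
theorem coord_lipschitz (c : ℝ) (b : Fin n → ℝ) (A : Matrix (Fin n) (Fin n) ℝ)
    (hA : ∀ i j, A i j = A j i) (hdiag : ∀ i, A i i = 0)
    {x : Fin n → ℝ} (hx : IsSignVec x) (i : Fin n) :
    |((c + ∑ k, b k * Function.update x i 1 k + quadForm A (Function.update x i 1)) -
      (c + ∑ k, b k * Function.update x i (-1) k + quadForm A (Function.update x i (-1)))) / 2|
      ≤ |b i| + 2 * ∑ j, |A i j| := by
  rw [coord_derivative c b A (hdiag i) x,
    show (2 * b i + 2 * lineCoeff A x i) / 2 = b i + lineCoeff A x i by ring]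
  have h := lineCoeff_abs_le A hA hx i
  calc |b i + lineCoeff A x i| ≤ |b i| + |lineCoeff A x i| := abs_add_le _ _
    _ ≤ |b i| + 2 * ∑ j, |A i j| := by linarith

/-! ## LEMMA M -/

/-- **LEMMA M (conditional on Grothendieck's inequality).** For a bounded quadratic
`q = c + ⟨b,x⟩ + xᵀAx ∈ [0,1]` on `{−1,1}ⁿ` (`A` symmetric, zero diagonal) the coordinate Lipschitz
constants `Lipᵢ = |bᵢ| + 2Σ_j|A i j|` satisfy `Σᵢ Lipᵢ² ≤ 1/2 + 8·krivineBound²`. -/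
theorem lipschitz_sq_sum_le (hGT : GrothendieckFactorization) (c : ℝ) (b : Fin n → ℝ)
    (A : Matrix (Fin n) (Fin n) ℝ) (hA : ∀ i j, A i j = A j i) (hdiag : ∀ i, A i i = 0)
    (hq : ∀ x, IsSignVec x →
      0 ≤ c + ∑ i, b i * x i + quadForm A x ∧ c + ∑ i, b i * x i + quadForm A x ≤ 1) :
    ∑ i, (|b i| + 2 * ∑ j, |A i j|) ^ 2 ≤ 1 / 2 + 8 * krivineBound ^ 2 := by
  have hM : ∀ s t : Fin n → ℝ, (∀ i, s i = 1 ∨ s i = -1) → (∀ j, t j = 1 ∨ t j = -1) →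
      |∑ i, ∑ j, A i j * s i * t j| ≤ 1 :=
    fun s t hs ht => sign_bilinear_abs_le_one c b A hA hdiag hq hs ht
  have hA2 : ∑ i, (∑ j, |A i j|) ^ 2 ≤ krivineBound ^ 2 := by
    simpa using row_l1_sq_sum_le hGT A hA zero_le_one hM
  have hb1 : 2 * ∑ i, |b i| ≤ 1 - 0 := linear_part_l1_le c b A hq
  have hb0 : 0 ≤ ∑ i, |b i| := sum_nonneg fun i _ => abs_nonneg _
  have hb2 : ∑ i, b i ^ 2 ≤ (∑ i, |b i|) ^ 2 := by
    rw [sq, sum_mul_sum]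
    refine sum_le_sum fun i _ => ?_
    have : b i ^ 2 = |b i| * |b i| := by rw [← sq, sq_abs]
    rw [this]
    exact single_le_sum (f := fun j => |b i| * |b j|)
      (fun j _ => mul_nonneg (abs_nonneg _) (abs_nonneg _)) (mem_univ i)
  have hb3 : ∑ i, b i ^ 2 ≤ 1 / 4 := by nlinarith
  calc ∑ i, (|b i| + 2 * ∑ j, |A i j|) ^ 2
        ≤ ∑ i, (2 * b i ^ 2 + 8 * (∑ j, |A i j|) ^ 2) := by
          refine sum_le_sum fun i _ => ?_
          have h : (|b i| + 2 * ∑ j, |A i j|) ^ 2 ≤ 2 * |b i| ^ 2 + 2 * (2 * ∑ j, |A i j|) ^ 2 := by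
            nlinarith [sq_nonneg (|b i| - 2 * ∑ j, |A i j|)]
          calc _ ≤ _ := h
            _ = 2 * b i ^ 2 + 8 * (∑ j, |A i j|) ^ 2 := by rw [sq_abs]; ring
    _ = 2 * ∑ i, b i ^ 2 + 8 * ∑ i, (∑ j, |A i j|) ^ 2 := by
          rw [sum_add_distrib, mul_sum, mul_sum]
    _ ≤ 2 * (1 / 4) + 8 * krivineBound ^ 2 := by linarith
    _ = 1 / 2 + 8 * krivineBound ^ 2 := by ring

/-- LEMMA M numerically: `Σᵢ Lipᵢ² < 65/2` (`krivineBound < 2`). -/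
theorem lipschitz_sq_sum_lt (hGT : GrothendieckFactorization) (c : ℝ) (b : Fin n → ℝ)
    (A : Matrix (Fin n) (Fin n) ℝ) (hA : ∀ i j, A i j = A j i) (hdiag : ∀ i, A i i = 0)
    (hq : ∀ x, IsSignVec x →
      0 ≤ c + ∑ i, b i * x i + quadForm A x ∧ c + ∑ i, b i * x i + quadForm A x ≤ 1) :
    ∑ i, (|b i| + 2 * ∑ j, |A i j|) ^ 2 < 65 / 2 := by
  have h := lipschitz_sq_sum_le hGT c b A hA hdiag hq
  have hK := krivineBound_lt_two
  have hK0 := krivineBound_pos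
  nlinarith

/-- **Few influential coordinates.** Under the hypotheses of LEMMA M, at most `(1/2 + 8K²)/t²`
coordinates have `Lipᵢ ≥ t`. -/
theorem influential_coords_card_le (hGT : GrothendieckFactorization) (c : ℝ) (b : Fin n → ℝ)
    (A : Matrix (Fin n) (Fin n) ℝ) (hA : ∀ i j, A i j = A j i) (hdiag : ∀ i, A i i = 0)
    (hq : ∀ x, IsSignVec x →
      0 ≤ c + ∑ i, b i * x i + quadForm A x ∧ c + ∑ i, b i * x i + quadForm A x ≤ 1)
    {t : ℝ} (ht : 0 < t) :
    ((univ.filter fun i => t ≤ |b i| + 2 * ∑ j, |A i j|).card : ℝ)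
      ≤ (1 / 2 + 8 * krivineBound ^ 2) / t ^ 2 := by
  have hS := lipschitz_sq_sum_le hGT c b A hA hdiag hq
  rw [le_div_iff₀ (by positivity)]
  calc ((univ.filter fun i => t ≤ |b i| + 2 * ∑ j, |A i j|).card : ℝ) * t ^ 2
        = ∑ i ∈ univ.filter (fun i => t ≤ |b i| + 2 * ∑ j, |A i j|), t ^ 2 := by
          rw [sum_const, nsmul_eq_mul]
    _ ≤ ∑ i ∈ univ.filter (fun i => t ≤ |b i| + 2 * ∑ j, |A i j|), (|b i| + 2 * ∑ j, |A i j|) ^ 2 :=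
          sum_le_sum fun i hi => pow_le_pow_left₀ ht.le (mem_filter.mp hi).2 2
    _ ≤ ∑ i, (|b i| + 2 * ∑ j, |A i j|) ^ 2 :=
          sum_le_sum_of_subset_of_nonneg (filter_subset _ _) fun i _ _ => sq_nonneg _
    _ ≤ 1 / 2 + 8 * krivineBound ^ 2 := hS

end BoundedQuadratic

end Summit.QuantumAdvantage.QuantumAdvantage.Theorems
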